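import Mathlib

/-!
# Route `ManinLocalTwoThree` — LEMMA W (the WIEFERICH LEVEL): a primitive Dirichlet character of
# conductor `qⁿ` is non-trivial at every `x` with `v_q(x^{q-1} - 1) < n`
# (cell bsd-f2-manin, analytic lens row S-an-53, MEMO-an §71.2; helper for crux C3
# `ManinPrimeToThreeAtNine` stmt-BirchSwinnertonDyer-22968 and its twin C2 `ManinOddAtFour`)

This is the only arithmetic input of the SINGLE-PRIME `q`-TOWER reduction (MEMO-an §71, typed in
HOME/an/g29/Sketch-an-g29.lean f73c501472290adc as the `Prop` `BsdF2ManinAnG29.WieferichLevel`): for an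
odd prime `q`, an integer `x > 1` prime to `q` and `n > s := v_q(x^{q-1} - 1)`, EVERY primitive Dirichlet
character `χ` of conductor `qⁿ` has `χ(x) ≠ 1`.  With `x = 9` (resp. `x = 8`) it discharges the side
condition `χ(3) ∉ {±1}` (resp. `χ(8) ≠ 1`) of the tree's polar witnesses
`…ManinAdditive.KatoCurve.ThreeAdicPolarWitness` / `TwoAdicPolarWitness` for every primitive character of
conductor `qⁿ`, `n > s` — see the companion file `ManinLocalTwoThreeTowerReduction.lean` (E-an-136).

Proof (elementary, §71.2): `s < n` says `x^{q-1} ≢ 1 (mod qⁿ)`, so the order of `x̄ ∈ (ℤ/qⁿ)ˣ` does not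
divide `q - 1`; as it divides `q^{n-1}(q-1)` it is divisible by `q`, and `z := x̄^{ord/q}` has order `q`.
The group `(ℤ/qⁿ)ˣ` is cyclic (`q` odd, Mathlib `ZMod.isCyclic_units_of_prime_pow`), so every `a` with
`a^q = 1` is a power of `z` (at most `q` solutions of `a^q = 1` in a cyclic group).  Every unit
`w ≡ 1 (mod q^{n-1})` satisfies `w^q = 1` (binomial theorem, `n ≥ 2`), hence is a power of `x̄`; so if
`χ(x̄) = 1` then `χ` kills the kernel of `(ℤ/qⁿ)ˣ → (ℤ/q^{n-1})ˣ`, i.e. factors through `q^{n-1}`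
(`DirichletCharacter.factorsThrough_iff_ker_unitsMap`) — contradicting primitivity.

The main theorem `wieferichLevel` is stated with the signature of `BsdF2ManinAnG29.WieferichLevel`
VERBATIM (by value; the def is not in the tree), so the typed `Prop` closes by `wieferichLevel` once landed.
BSD is not proved by this file; Manin's conjecture is not proved by this file.
-/

set_option autoImplicit false
set_option linter.dupNamespace false

namespace Summit.BirchSwinnertonDyer.BirchSwinnertonDyer.Theorems.ManinLocalTwoThree

open DirichletCharacter

/-- In a finite cyclic group an element `z` of order `d > 0` generates ALL solutions of `a ^ d = 1`
(there are at most `d` of them, `IsCyclic.card_pow_eq_one_le`, and the `d` powers of `z` are solutions). -/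
theorem exists_pow_eq_of_pow_eq_one_of_orderOf_eq {G : Type*} [Group G] [Fintype G] [IsCyclic G]
    {z a : G} {d : ℕ} (hd : 0 < d) (hz : orderOf z = d) (ha : a ^ d = 1) :
    ∃ i < d, z ^ i = a := by
  classical
  set T : Finset G := Finset.univ.filter (fun b : G => b ^ d = 1) with hT
  set S : Finset G := (Finset.range d).image (fun i : ℕ => z ^ i) with hS
  have hST : S ⊆ T := by
    intro b hb
    obtain ⟨i, -, rfl⟩ := Finset.mem_image.mp hb
    simp only [hT, Finset.mem_filter, Finset.mem_univ, true_and]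
    rw [← pow_mul, mul_comm, pow_mul, ← hz, pow_orderOf_eq_one, one_pow]
  have hcardS : S.card = d := by
    rw [hS, Finset.card_image_of_injOn, Finset.card_range]
    rw [Finset.coe_range, ← hz]
    exact pow_injOn_Iio_orderOf
  have hcardT : T.card ≤ d := by
    have h := IsCyclic.card_pow_eq_one_le (α := G) hd
    convert h
  have hTS : S = T := Finset.eq_of_subset_of_card_le hST (by rw [hcardS]; exact hcardT)
  have haT : a ∈ T := by simp [hT, ha]
  rw [← hTS, hS, Finset.mem_image] at haT
  obtain ⟨i, hi, rfl⟩ := haT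
  exact ⟨i, Finset.mem_range.mp hi, rfl⟩

/-- A unit of `ZMod (q ^ n)` congruent to `1` modulo `q ^ (n - 1)` (i.e. in the kernel of the reduction
`(ZMod (q^n))ˣ → (ZMod (q^(n-1)))ˣ`) has `q`-th power `1`, for `q` prime and `n ≥ 2` (binomial theorem). -/
theorem pow_eq_one_of_mem_ker_unitsMap {q n : ℕ} (hq : q.Prime) (hn : 2 ≤ n)
    (w : (ZMod (q ^ n))ˣ) (hw : w ∈ (ZMod.unitsMap (pow_dvd_pow q (Nat.sub_le n 1))).ker) :
    w ^ q = 1 := by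
  haveI : Fact q.Prime := ⟨hq⟩
  haveI : NeZero (q ^ n) := ⟨pow_ne_zero _ hq.ne_zero⟩
  have hw0 : (((w : ZMod (q ^ n)).val : ℕ) : ZMod (q ^ (n - 1))) = 1 := by
    have h := hw
    rw [MonoidHom.mem_ker, Units.ext_iff, ZMod.unitsMap_val, ← ZMod.natCast_val, Units.val_one] at h
    exact h
  have hw1 : (w : ZMod (q ^ n)).val ≡ 1 [MOD q ^ (n - 1)] := by
    rw [← ZMod.natCast_eq_natCast_iff, Nat.cast_one]; exact hw0
  set W : ℕ := (w : ZMod (q ^ n)).val with hWdef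
  have hqn1 : 1 < q ^ (n - 1) := Nat.one_lt_pow (by omega) hq.one_lt
  have hWmod : W % q ^ (n - 1) = 1 := by
    have h : W % q ^ (n - 1) = 1 % q ^ (n - 1) := hw1
    rwa [Nat.mod_eq_of_lt hqn1] at h
  have hWdec : W = q ^ (n - 1) * (W / q ^ (n - 1)) + 1 := by
    have := Nat.div_add_mod W (q ^ (n - 1))
    omega
  set t : ℕ := W / q ^ (n - 1) with ht
  have hwval : (w : ZMod (q ^ n)) = 1 + (q : ZMod (q ^ n)) ^ (n - 1) * (t : ZMod (q ^ n)) := by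
    calc (w : ZMod (q ^ n)) = ((W : ℕ) : ZMod (q ^ n)) := (ZMod.natCast_zmod_val _).symm
      _ = ((q ^ (n - 1) * t + 1 : ℕ) : ZMod (q ^ n)) := by rw [← hWdec]
      _ = 1 + (q : ZMod (q ^ n)) ^ (n - 1) * (t : ZMod (q ^ n)) := by push_cast; ring
  -- binomial theorem: `(1 + q^(n-1) t)^q = 1 + q · q^(n-1) · (…) = 1` in `ZMod (q^n)`
  have hqn0 : ((q : ZMod (q ^ n)) ^ n) = 0 := by
    rw [← Nat.cast_pow, ZMod.natCast_self]
  have hu : ((q : ZMod (q ^ n)) ^ (n - 1)) ∣ ((q : ZMod (q ^ n)) ^ (n - 1)) := dvd_rfl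
  have hpuv : (q : ZMod (q ^ n)) * (q : ZMod (q ^ n)) ^ (n - 1) * (q : ZMod (q ^ n)) ^ (n - 1) ∣
      ((q : ZMod (q ^ n)) ^ (n - 1)) ^ q := by
    have h1 : (q : ZMod (q ^ n)) * (q : ZMod (q ^ n)) ^ (n - 1) * (q : ZMod (q ^ n)) ^ (n - 1) = 0 := by
      have : (q : ZMod (q ^ n)) * (q : ZMod (q ^ n)) ^ (n - 1) = (q : ZMod (q ^ n)) ^ n := by
        rw [← pow_succ']; congr 1; omega
      rw [this, hqn0, zero_mul]
    have h2 : ((q : ZMod (q ^ n)) ^ (n - 1)) ^ q = 0 := by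
      rw [← pow_mul]
      have hle : n ≤ (n - 1) * q := by
        have := hq.two_le
        calc n ≤ (n - 1) * 2 := by omega
          _ ≤ (n - 1) * q := Nat.mul_le_mul_left _ this
      obtain ⟨k, hk⟩ := Nat.exists_eq_add_of_le hle
      rw [hk, pow_add, hqn0, zero_mul]
    rw [h1, h2]
  obtain ⟨y, hy⟩ := ZMod.exists_one_add_mul_pow_prime_eq hq hu hpuv (t : ZMod (q ^ n))
  have hmain : (w : ZMod (q ^ n)) ^ q = 1 := by
    rw [hwval, hy]
    have : (q : ZMod (q ^ n)) * (q : ZMod (q ^ n)) ^ (n - 1) = 0 := by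
      have h' : (q : ZMod (q ^ n)) * (q : ZMod (q ^ n)) ^ (n - 1) = (q : ZMod (q ^ n)) ^ n := by
        rw [← pow_succ']; congr 1; omega
      rw [h', hqn0]
    rw [this, zero_mul, add_zero]
  exact Units.ext (by rw [Units.val_pow_eq_pow_val, hmain, Units.val_one])

/-- **LEMMA W — the Wieferich level** (cell bsd-f2-manin row S-an-53, MEMO-an §71.2; the signature is
`BsdF2ManinAnG29.WieferichLevel` of HOME/an/g29/Sketch-an-g29.lean VERBATIM).  For an odd prime `q`,
`x > 1` prime to `q` and `n > v_q(x^{q-1} - 1)`, every PRIMITIVE Dirichlet character `χ` of conductor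
`qⁿ` satisfies `χ(x) ≠ 1`: the cyclic subgroup `⟨x̄⟩ ≤ (ℤ/qⁿ)ˣ` contains the kernel of reduction modulo
`q^{n-1}`, on which a primitive character cannot be trivial. -/
theorem wieferichLevel :
    ∀ (q x n : ℕ), q.Prime → q ≠ 2 → 1 < x → ¬ q ∣ x → padicValNat q (x ^ (q - 1) - 1) < n →
      ∀ χ : DirichletCharacter ℂ (q ^ n), χ.IsPrimitive → χ (x : ZMod (q ^ n)) ≠ 1 := by
  intro q x n hq hq2 hx hqx hs χ hχ hχx
  haveI : Fact q.Prime := ⟨hq⟩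
  haveI : NeZero (q ^ n) := ⟨pow_ne_zero _ hq.ne_zero⟩
  have hq3 : 3 ≤ q := by
    rcases hq.eq_two_or_odd' with h | h
    · exact absurd h hq2
    · have := hq.two_le; rcases h with ⟨k, hk⟩; omega
  have hxq1 : 1 ≤ x ^ (q - 1) := Nat.one_le_pow _ _ (by omega)
  have hne : x ^ (q - 1) - 1 ≠ 0 := by
    have : 1 < x ^ (q - 1) := Nat.one_lt_pow (by omega) hx
    omega
  -- `s < n` says `qⁿ ∤ x^{q-1} - 1`
  have hndvd : ¬ q ^ n ∣ x ^ (q - 1) - 1 := by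
    rw [padicValNat_dvd_iff_le hne]; omega
  -- the unit `x̄`
  have hcop : x.Coprime (q ^ n) :=
    Nat.Coprime.pow_right _ (Nat.coprime_comm.mp ((Nat.Prime.coprime_iff_not_dvd hq).mpr hqx))
  set xu : (ZMod (q ^ n))ˣ := ZMod.unitOfCoprime x hcop with hxu
  have hxu_coe : (xu : ZMod (q ^ n)) = x := ZMod.coe_unitOfCoprime x hcop
  have hpow : xu ^ (q - 1) ≠ 1 := by
    intro h
    apply hndvd
    have h' : ((x ^ (q - 1) : ℕ) : ZMod (q ^ n)) = ((1 : ℕ) : ZMod (q ^ n)) := by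
      rw [Nat.cast_pow, ← hxu_coe, ← Units.val_pow_eq_pow_val, h, Units.val_one, Nat.cast_one]
    rw [ZMod.natCast_eq_natCast_iff] at h'
    exact (Nat.modEq_iff_dvd' hxq1).mp h'.symm
  -- `q ∣ orderOf x̄`
  have hn1 : 1 ≤ n := by omega
  have hord_dvd : orderOf xu ∣ q ^ (n - 1) * (q - 1) := by
    have h := orderOf_dvd_of_pow_eq_one (ZMod.pow_totient xu)
    rwa [Nat.totient_prime_pow hq hn1] at h
  have hq_ord : q ∣ orderOf xu := by
    by_contra hnot
    have hco : Nat.Coprime (orderOf xu) (q ^ (n - 1)) :=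
      Nat.Coprime.pow_right _ (Nat.coprime_comm.mp ((Nat.Prime.coprime_iff_not_dvd hq).mpr hnot))
    have : orderOf xu ∣ q - 1 := hco.dvd_of_dvd_mul_left hord_dvd
    exact hpow (orderOf_dvd_iff_pow_eq_one.mp this)
  -- hence `n ≥ 2` (for `n = 1` the order would divide `q - 1`)
  have hn2 : 2 ≤ n := by
    by_contra hlt
    have hn : n = 1 := by omega
    have h1 : q ^ (n - 1) * (q - 1) = q - 1 := by rw [hn, Nat.sub_self, pow_zero, one_mul]
    rw [h1] at hord_dvd
    exact hpow (orderOf_dvd_iff_pow_eq_one.mp hord_dvd)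
  -- `z := x̄^{ord/q}` has order exactly `q`
  set z : (ZMod (q ^ n))ˣ := xu ^ (orderOf xu / q) with hz
  have hz_ord : orderOf z = q := orderOf_pow_orderOf_div (orderOf_pos xu).ne' hq_ord
  -- cyclicity of `(ℤ/qⁿ)ˣ` for odd `q`
  haveI : IsCyclic (ZMod (q ^ n))ˣ := ZMod.isCyclic_units_of_prime_pow q hq hq2 n
  -- `χ` kills the kernel of reduction modulo `q^{n-1}`
  have hdvd : q ^ (n - 1) ∣ q ^ n := pow_dvd_pow q (Nat.sub_le n 1)
  have hker : (ZMod.unitsMap hdvd).ker ≤ χ.toUnitHom.ker := by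
    intro w hw
    have hwq : w ^ q = 1 := pow_eq_one_of_mem_ker_unitsMap hq hn2 w hw
    obtain ⟨i, -, rfl⟩ := exists_pow_eq_of_pow_eq_one_of_orderOf_eq hq.pos hz_ord hwq
    rw [MonoidHom.mem_ker, Units.ext_iff, MulChar.coe_toUnitHom, Units.val_one, hz, ← pow_mul,
      Units.val_pow_eq_pow_val, map_pow, hxu_coe, hχx, one_pow]
  have hfac : χ.FactorsThrough (q ^ (n - 1)) := (factorsThrough_iff_ker_unitsMap hdvd).mpr hker
  -- so the conductor is at most `q^{n-1} < qⁿ`, contradicting primitivity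
  have hcond : χ.conductor ≤ q ^ (n - 1) := Nat.sInf_le ((mem_conductorSet_iff χ).mpr hfac)
  rw [(isPrimitive_def χ).mp hχ] at hcond
  have hlt : q ^ (n - 1) < q ^ n := Nat.pow_lt_pow_right hq.one_lt (by omega)
  omega

end Summit.BirchSwinnertonDyer.BirchSwinnertonDyer.Theorems.ManinLocalTwoThree
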